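import Literature.Analysis.FluidPDE.LocalTypeI
import Mathlib.MeasureTheory.Function.ConvergenceInMeasure
import HarnessLib

/-!
# Transfer of a backward singularity from an `L³`-limit to the pointwise limit
# (route `AdaptedFrequency`, item `TangentFlowTransfer`, stmt-NavierStokesRegularity-10494)

Helper file (all results proved), preparing the residual hypothesis (P) (persistence of the
singularity in the blow-up limit) of `tangentFlowTransfer_of_persistence`: persistence theorems
(Albritton–Barker 2019, Prop. 2.3, `PersistenceOfSingularities_holds`) conclude that the `L³(Q(a))`
limit of rescaled velocities is backward-singular at the origin, while (P) asks it for the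
slice-wise pointwise limit `W` of the same velocities. The two limits agree a.e. on every
parabolic cylinder (an `L³`-convergent sequence converges in measure, hence a.e. along a
subsequence), and backward singularity only depends on the a.e. class
(`isBackwardSingularPoint_of_L3_limit_of_pointwise_limit`).
-/

noncomputable section

open MeasureTheory Set Function Filter TopologicalSpace Metric
open scoped Topology ENNReal

namespace Summit.NavierStokesRegularity.NavierStokesRegularity.Theorems

open Literature.Analysis Literature.Analysis.FluidPDE

local notation "ℝ³" => EuclideanSpace ℝ (Fin 3)

/-- **`Lᵖ` and pointwise limits agree a.e.** If `f_k → g` in `Lᵖ(μ)` (`p ≠ 0`) and `f_k → h`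
`μ`-a.e., then `g = h` `μ`-a.e. (convergence in measure and an a.e. convergent subsequence).
[folklore] -/
theorem ae_eq_of_tendsto_eLpNorm_of_tendsto_ae {α : Type*} [MeasurableSpace α] {μ : Measure α}
    {E : Type*} [NormedAddCommGroup E] {p : ℝ≥0∞} (hp : p ≠ 0) {f : ℕ → α → E} {g h : α → E}
    (hf : ∀ n, AEStronglyMeasurable (f n) μ) (hg : AEStronglyMeasurable g μ)
    (hfg : Tendsto (fun n => eLpNorm (f n - g) p μ) atTop (𝓝 0))
    (hfh : ∀ᵐ x ∂μ, Tendsto (fun n => f n x) atTop (𝓝 (h x))) : g =ᵐ[μ] h := by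
  have hmeas := tendstoInMeasure_of_tendsto_eLpNorm hp hf hg hfg
  obtain ⟨ns, hns, hae⟩ := hmeas.exists_seq_tendsto_ae
  filter_upwards [hae, hfh] with x hxg hxh
  exact tendsto_nhds_unique hxg (hxh.comp hns.tendsto_atTop)

/-- Backward singularity is a property of the a.e. class on the parabolic cylinders at the point.
[folklore] -/
theorem isBackwardSingularPoint_congr_ae {u v : ℝ → ℝ³ → ℝ³} {z : ℝ × ℝ³}
    (h : ∀ r : ℝ, 0 < r → uncurry u =ᵐ[volume.restrict (parabolicCylinder r z)] uncurry v)
    (hu : IsBackwardSingularPoint u z) : IsBackwardSingularPoint v z := by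
  intro r hr
  rw [← eLpNorm_congr_ae (h r hr)]
  exact hu r hr

/-- **Transfer of a backward singularity from the `L³`-limit to the pointwise limit.** Let the
velocities `w_j` converge to `V` in `L³` of every parabolic cylinder `Q(a)` at the origin and
pointwise to `W` at every `(t, x)` with `t < 0`. If the origin is a backward singular point of
`V`, it is one of `W`. [folklore] -/
theorem isBackwardSingularPoint_of_L3_limit_of_pointwise_limit {w : ℕ → ℝ → ℝ³ → ℝ³}
    {V W : ℝ → ℝ³ → ℝ³}
    (hmeas : ∀ j, ∀ a : ℝ, 0 < a → AEStronglyMeasurable (uncurry (w j))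
      (volume.restrict (parabolicCylinder a ((0 : ℝ), (0 : ℝ³)))))
    (hVmeas : ∀ a : ℝ, 0 < a → AEStronglyMeasurable (uncurry V)
      (volume.restrict (parabolicCylinder a ((0 : ℝ), (0 : ℝ³)))))
    (hL3 : ∀ a : ℝ, 0 < a → Tendsto (fun j => eLpNorm (uncurry (w j) - uncurry V) 3
      (volume.restrict (parabolicCylinder a ((0 : ℝ), (0 : ℝ³))))) atTop (𝓝 0))
    (hpt : ∀ t < 0, ∀ x, Tendsto (fun j => w j t x) atTop (𝓝 (W t x)))
    (hsing : IsBackwardSingularPoint V ((0 : ℝ), (0 : ℝ³))) :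
    IsBackwardSingularPoint W ((0 : ℝ), (0 : ℝ³)) := by
  refine isBackwardSingularPoint_congr_ae (fun a ha => ?_) hsing
  refine ae_eq_of_tendsto_eLpNorm_of_tendsto_ae (p := 3) (by norm_num) (fun j => hmeas j a ha)
    (hVmeas a ha) (hL3 a ha) ?_
  rw [ae_restrict_iff' (isOpen_parabolicCylinder a _).measurableSet]
  refine Eventually.of_forall fun p hp => ?_
  have ht : p.1 < 0 := by
    simp only [parabolicCylinder, mem_prod, mem_Ioo] at hp
    exact hp.1.2
  exact hpt p.1 ht p.2

end Summit.NavierStokesRegularity.NavierStokesRegularity.Theorems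

end
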